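import Summits.QuantumFields.BalabanUV.Beta.KKTInverseRegularity

/-!
# `BalabanUV.Beta.ConstrainedCriticalMap` — binder row D1, route (O3), work item W-2 ∕ K-U5: **THE CONSTRAINED CRITICAL POINT AS A `C^k`
# FUNCTION OF THE CONSTRAINT VALUE** (Lagrange ∕ KKT system + the inverse function theorem): existence, local uniqueness, `U(c₀) = V₀`,
# `dU = minOp`, `dω = −effForm` along the branch (the ENVELOPE identities and the sliced ∕ K-U2e plug are the sequel K-U5b)
# (β sub-cell, BINDER-OWNERS row D1 OWNER, lineage an2 gen 24; discharges the shape of hypothesis (h-U) of K-U2e `PolarizationTelescopingCompSlice`)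

HONEST FRAMING (cell charter, verbatim): «discharging BetaPertH makes Balaban's UV stability UNCONDITIONAL — a real
constructive-QFT result; it is NOT the continuum limit and NOT the Clay problem.»
HONEST DEPENDENCY: continuum YM on T⁴ ⇐ BetaPertH ∧ nine spine estimates (0/9 proved); BetaPertH ⇐ (D1) ∧ (D4) ∧ CAP+tail;
G-an2-4 gates asym, D1 and NE2/3/4.
ABSOLUTE RULE (cell, verbatim): «No internally-minted statement may enter as a cited fact. Every hypothesis is either kernel-proved in this
package or a verbatim quotation of a PUBLISHED theorem with page reference. The manuscript(s) under audit are NOT citable for their own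
disputed steps — they are the thing under adjudication; programme-internal (2001/route/tribunal) claims are never citable.»
NOTHING below is cited: no `[cite: …]`, no `Prop` fact.  Six DATA definitions ([our object] plumbing: a matrix ∕ a vector as a continuous linear
map, the Lagrange map, the bordered operator, its block inverse, the resulting equivalence) and [folklore] theorems of finite-dimensional calculus:
Mathlib's inverse function theorem (`ContDiffAt.to_localInverse`, `HasStrictFDerivAt.localInverse ∕ to_localInverse ∕ eventually_{left,right}_inverse`)
applied to the Lagrange map, over an2's `CompositionSingular` (`flucCov ∕ minOp ∕ minOpL ∕ effForm`, `kkt_mul_blocks`, `blocks_mul_kkt`) BY NAME.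
It asserts nothing about Bałaban's objects: the Euler–Lagrange field `f` (meant: the gradient of a lattice action in a chart), the constraint matrix
`C` (meant: stacked linearised averaging-and-gauge-slice `[Q̃; τ]`), the base point and the nondegeneracy of the bordered matrix are PARAMETERS ∕
HYPOTHESES.  (Orientation only, not cited, not used: the minimiser of [Balaban1985VariationalBackground] Thm 1 — tree carrier `B11Thm1` — is the
genuine non-linear group-valued object of which this is the chart-level finite-dimensional shape.)

WHY (row-D1 owner, gen 24; `ROUTE-O3.md` §3 W-2; `BETA/AN2.md` §51.7).  At matrix level ROUTE (O3) is a chain of tree theorems K-U2 … K-U2f modulo ONE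
displayed non-primitive hypothesis (h-U): the STEP MINIMISER `U` — the level-1 configuration determined by the level-2 background — as a `C²` map with
`U 0 = 0` (K-U2e `polarization_telescoping_comp_slice`, binders `hU0`, `hU`).  For honest objects `U` is the constrained critical point of the
level-1 action on the fibre `{[Q̃₂; τ₂] V = (B, 0)}`; this file supplies it from VARIATIONAL DATA: `C^k` Euler–Lagrange field with Jacobian `H` at a
constrained critical point and `IsUnit (kkt H C).det` ⟹ a `C^k` branch `c ↦ (U c, ω c)` of constrained critical points through the base point, locally
unique, with `dU = minOp H C`, `dω = −effForm H C` (the blocks of the bordered inverse, `CompositionSingular`).  The envelope identities (`∇(A ∘ U) = −ω`,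
`Hess(A ∘ U) = effForm(H_c, C)`: the step family's form IS the Hessian of the tree-level effective action), the sliced specialisation (`C = [Q; τ]`,
value `(B, 0)`) and the plug into K-U2e are the sequel K-U5b.

WHAT (`κ`, `μ` finite coordinate types — fine configurations and constraint values ∕ multipliers; all [folklore] unless marked [our object]):
§1 [our object] `mulVecCLM A` (`v ↦ A *ᵥ v` as a CLM), `dotCLM` (`w ↦ (v ↦ w ⬝ᵥ v)`), `kktCLM H C` (`(v, m) ↦ (Hv + Cᵀm, Cv)`), `kktInvCLM H C`
   (`(w, d) ↦ (𝒢w + ℋd, ℋ♭w − 𝒮d)`); `kktCLM_comp_kktInvCLM` ∕ `kktInvCLM_comp_kktCLM` (two-sided inverse under `IsUnit (kkt H C).det`), `kktEquiv`.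
§2 [our object] `lagrangeMap f C` (`(V, ω) ↦ (f V + Cᵀω, C V)`); `contDiffAt_lagrangeMap`, `hasFDerivAt_lagrangeMap` (derivative `kktCLM H C`).
§3 **`exists_criticalMap`**: `f` `C^k` (`k ≠ 0`) at `V₀` with `HasFDerivAt f (mulVecCLM H) V₀`, `f V₀ + Cᵀω₀ = 0`, `IsUnit (kkt H C).det` ⟹ ∃ `U`, `ω`:
   `U (C V₀) = V₀`, `ω (C V₀) = ω₀`, both `C^k` at `C V₀`, `f (U c) + Cᵀ ω c = 0 ∧ C (U c) = c` for `c` near `C V₀`, every constrained critical pair near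
   `(V₀, ω₀)` lies on the branch, `HasFDerivAt U (mulVecCLM (minOp H C))`, `HasFDerivAt ω (−mulVecCLM (effForm H C))` at `C V₀`;
   **`exists_criticalMap_zero`** (base point `0`, `f 0 = 0`: `U 0 = 0` — the (h-U) shape).
§4 **`fderiv_eq_of_identities`** (ANY differentiable pair satisfying the two identities near `c`, Jacobian `H_c` of `f` at `U c`, `IsUnit (kkt H_c C).det` ⟹
   `fderiv U c = mulVecCLM (minOp H_c C)`, `fderiv ω c = −mulVecCLM (effForm H_c C)` — so the derivative formulas hold along the whole branch).
Provenance: β sub-cell, unit beta-an2 gen 24 (prover-b2b-balaban-beta-an2-g24-0), 2026-08-20.  NOT (SDF), NOT D1, NOT `BetaPertH`, NOT continuum, NOT Clay.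
-/

noncomputable section

open Matrix Topology Filter
open scoped Matrix
open Literature.MathematicalPhysics.QuantumFieldTheory.Balaban1983to89.Beta.Composition (kkt)
open Literature.MathematicalPhysics.QuantumFieldTheory.Balaban1983to89.Beta.CompositionSingular (flucCov minOp minOpL effForm
  kkt_mul_blocks blocks_mul_kkt)

namespace Summit.QuantumFields.BalabanUV.Beta.ConstrainedCriticalMap

/-! ## §1 Matrices and vectors as continuous linear maps; the bordered operator and its block inverse -/

section CLM

variable {α β γ : Type*} [Fintype β] [Fintype γ]

/-- [our object] A real matrix acting on coordinate vectors, as a continuous linear map: `mulVecCLM A v = A *ᵥ v`. -/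
def mulVecCLM (A : Matrix α β ℝ) : (β → ℝ) →L[ℝ] (α → ℝ) :=
  LinearMap.toContinuousLinearMap (Matrix.mulVecLin A)

/-- `mulVecCLM A v = A *ᵥ v`. [folklore] -/
@[simp] theorem mulVecCLM_apply (A : Matrix α β ℝ) (v : β → ℝ) : mulVecCLM A v = A *ᵥ v := rfl

/-- `mulVecCLM (A * B) = mulVecCLM A ∘L mulVecCLM B`. [folklore] -/
theorem mulVecCLM_mul (A : Matrix α β ℝ) (B : Matrix β γ ℝ) : mulVecCLM (A * B) = mulVecCLM A ∘L mulVecCLM B := by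
  ext v : 1
  simp [Matrix.mulVec_mulVec]

/-- `mulVecCLM (-A) = -mulVecCLM A`. [folklore] -/
theorem mulVecCLM_neg (A : Matrix α β ℝ) : mulVecCLM (-A) = -mulVecCLM A := by
  ext v : 1
  simp [Matrix.neg_mulVec]

variable [DecidableEq β] in
/-- [our object] The dot product with a fixed vector as a continuous linear functional, linearly in the vector: `dotCLM w v = w ⬝ᵥ v`. -/
def dotCLM : (β → ℝ) →L[ℝ] (β → ℝ) →L[ℝ] ℝ :=
  LinearMap.toContinuousLinearMap
    ((LinearMap.toContinuousLinearMap : ((β → ℝ) →ₗ[ℝ] ℝ) ≃ₗ[ℝ] ((β → ℝ) →L[ℝ] ℝ)).toLinearMap ∘ₗ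
      (dotProductEquiv ℝ β).toLinearMap)

variable [DecidableEq β] in
/-- `dotCLM w v = w ⬝ᵥ v`. [folklore] -/
@[simp] theorem dotCLM_apply (w v : β → ℝ) : dotCLM w v = w ⬝ᵥ v := rfl

end CLM

section KKT

variable {κ μ : Type*} [Fintype κ] [Fintype μ]

/-- [our object] The BORDERED (KKT) OPERATOR of `CompositionSingular.kkt H C = [[H, Cᵀ],[C, 0]]` as a continuous linear map on
`(κ → ℝ) × (μ → ℝ)`: `(v, m) ↦ (H v + Cᵀ m, C v)` — the linearisation of the Lagrange map. -/
def kktCLM (H : Matrix κ κ ℝ) (C : Matrix μ κ ℝ) : ((κ → ℝ) × (μ → ℝ)) →L[ℝ] ((κ → ℝ) × (μ → ℝ)) :=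
  ((mulVecCLM H).comp (ContinuousLinearMap.fst ℝ _ _) + (mulVecCLM Cᵀ).comp (ContinuousLinearMap.snd ℝ _ _)).prod
    ((mulVecCLM C).comp (ContinuousLinearMap.fst ℝ _ _))

/-- `kktCLM H C (v, m) = (H v + Cᵀ m, C v)`. [folklore] -/
@[simp] theorem kktCLM_apply (H : Matrix κ κ ℝ) (C : Matrix μ κ ℝ) (z : (κ → ℝ) × (μ → ℝ)) :
    kktCLM H C z = (H *ᵥ z.1 + Cᵀ *ᵥ z.2, C *ᵥ z.1) := rfl

variable [DecidableEq κ] [DecidableEq μ]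

/-- [our object] The BLOCK INVERSE of the bordered operator, read off `CompositionSingular`'s blocks of `(kkt H C)⁻¹ = [[𝒢, ℋ],[ℋ♭, −𝒮]]`:
`(w, d) ↦ (𝒢 w + ℋ d, ℋ♭ w − 𝒮 d)`. -/
def kktInvCLM (H : Matrix κ κ ℝ) (C : Matrix μ κ ℝ) : ((κ → ℝ) × (μ → ℝ)) →L[ℝ] ((κ → ℝ) × (μ → ℝ)) :=
  ((mulVecCLM (flucCov H C)).comp (ContinuousLinearMap.fst ℝ _ _) + (mulVecCLM (minOp H C)).comp (ContinuousLinearMap.snd ℝ _ _)).prod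
    ((mulVecCLM (minOpL H C)).comp (ContinuousLinearMap.fst ℝ _ _) - (mulVecCLM (effForm H C)).comp (ContinuousLinearMap.snd ℝ _ _))

/-- `kktInvCLM H C (w, d) = (𝒢 w + ℋ d, ℋ♭ w − 𝒮 d)`. [folklore] -/
@[simp] theorem kktInvCLM_apply (H : Matrix κ κ ℝ) (C : Matrix μ κ ℝ) (z : (κ → ℝ) × (μ → ℝ)) :
    kktInvCLM H C z = (flucCov H C *ᵥ z.1 + minOp H C *ᵥ z.2, minOpL H C *ᵥ z.1 - effForm H C *ᵥ z.2) := rfl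

/-- [folklore] RIGHT INVERSE: `kktCLM ∘ kktInvCLM = id` when the bordered matrix is nonsingular (`CompositionSingular.kkt_mul_blocks`). -/
theorem kktCLM_kktInvCLM (H : Matrix κ κ ℝ) (C : Matrix μ κ ℝ) (h : IsUnit (kkt H C).det) (z : (κ → ℝ) × (μ → ℝ)) :
    kktCLM H C (kktInvCLM H C z) = z := by
  obtain ⟨h11, h12, h21, h22⟩ := kkt_mul_blocks H C h
  obtain ⟨w, d⟩ := z
  simp only [kktCLM_apply, kktInvCLM_apply, Matrix.mulVec_add, Matrix.mulVec_sub, Matrix.mulVec_mulVec, Prod.mk.injEq]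
  constructor
  · calc (H * flucCov H C) *ᵥ w + (H * minOp H C) *ᵥ d + ((Cᵀ * minOpL H C) *ᵥ w - (Cᵀ * effForm H C) *ᵥ d)
          = (H * flucCov H C + Cᵀ * minOpL H C) *ᵥ w + ((H * minOp H C) *ᵥ d - (Cᵀ * effForm H C) *ᵥ d) := by
            rw [Matrix.add_mulVec]; abel
      _ = w := by rw [h11, h12, sub_self, add_zero, Matrix.one_mulVec]
  · rw [h21, h22, Matrix.zero_mulVec, zero_add, Matrix.one_mulVec]

/-- [folklore] LEFT INVERSE: `kktInvCLM ∘ kktCLM = id` when the bordered matrix is nonsingular (`CompositionSingular.blocks_mul_kkt`). -/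
theorem kktInvCLM_kktCLM (H : Matrix κ κ ℝ) (C : Matrix μ κ ℝ) (h : IsUnit (kkt H C).det) (z : (κ → ℝ) × (μ → ℝ)) :
    kktInvCLM H C (kktCLM H C z) = z := by
  obtain ⟨h11, h12, h21, h22⟩ := blocks_mul_kkt H C h
  obtain ⟨v, m⟩ := z
  simp only [kktCLM_apply, kktInvCLM_apply, Matrix.mulVec_add, Matrix.mulVec_mulVec, Prod.mk.injEq]
  constructor
  · calc (flucCov H C * H) *ᵥ v + (flucCov H C * Cᵀ) *ᵥ m + (minOp H C * C) *ᵥ v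
          = (flucCov H C * H + minOp H C * C) *ᵥ v + (flucCov H C * Cᵀ) *ᵥ m := by rw [Matrix.add_mulVec]; abel
      _ = v := by rw [h11, h12, Matrix.zero_mulVec, add_zero, Matrix.one_mulVec]
  · calc (minOpL H C * H) *ᵥ v + (minOpL H C * Cᵀ) *ᵥ m - (effForm H C * C) *ᵥ v
          = (minOpL H C * H - effForm H C * C) *ᵥ v + (minOpL H C * Cᵀ) *ᵥ m := by rw [Matrix.sub_mulVec]; abel
      _ = m := by rw [h21, h22, sub_self, Matrix.zero_mulVec, zero_add, Matrix.one_mulVec]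

/-- [our object] The bordered operator as a CONTINUOUS LINEAR EQUIVALENCE (nonsingular bordered matrix). -/
def kktEquiv (H : Matrix κ κ ℝ) (C : Matrix μ κ ℝ) (h : IsUnit (kkt H C).det) :
    ((κ → ℝ) × (μ → ℝ)) ≃L[ℝ] ((κ → ℝ) × (μ → ℝ)) :=
  ContinuousLinearEquiv.equivOfInverse (kktCLM H C) (kktInvCLM H C) (kktInvCLM_kktCLM H C h) (kktCLM_kktInvCLM H C h)

/-- `(kktEquiv H C h : _ →L _) = kktCLM H C`. [folklore] -/
@[simp] theorem coe_kktEquiv (H : Matrix κ κ ℝ) (C : Matrix μ κ ℝ) (h : IsUnit (kkt H C).det) :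
    (kktEquiv H C h : ((κ → ℝ) × (μ → ℝ)) →L[ℝ] ((κ → ℝ) × (μ → ℝ))) = kktCLM H C := rfl

/-- `(kktEquiv H C h).symm z = kktInvCLM H C z`. [folklore] -/
@[simp] theorem kktEquiv_symm_apply (H : Matrix κ κ ℝ) (C : Matrix μ κ ℝ) (h : IsUnit (kkt H C).det) (z : (κ → ℝ) × (μ → ℝ)) :
    (kktEquiv H C h).symm z = kktInvCLM H C z := rfl

end KKT

/-! ## §2 The Lagrange map and its derivative -/

section Lagrange

variable {κ μ : Type*} [Fintype κ] [Fintype μ]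

/-- [our object] The LAGRANGE (KKT) MAP of an Euler–Lagrange field `f` and a constraint matrix `C`: `(V, ω) ↦ (f V + Cᵀ ω, C V)`.  Its zero set in
the first component at constraint value `c` in the second = the constrained critical points of level `c` with multiplier `ω`. -/
def lagrangeMap (f : (κ → ℝ) → (κ → ℝ)) (C : Matrix μ κ ℝ) (z : (κ → ℝ) × (μ → ℝ)) : (κ → ℝ) × (μ → ℝ) :=
  (f z.1 + Cᵀ *ᵥ z.2, C *ᵥ z.1)

/-- `lagrangeMap f C (V, ω) = (f V + Cᵀ ω, C V)`. [folklore] -/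
@[simp] theorem lagrangeMap_apply (f : (κ → ℝ) → (κ → ℝ)) (C : Matrix μ κ ℝ) (z : (κ → ℝ) × (μ → ℝ)) :
    lagrangeMap f C z = (f z.1 + Cᵀ *ᵥ z.2, C *ᵥ z.1) := rfl

/-- [folklore] The Lagrange map is `C^k` at `z` when `f` is `C^k` at `z.1`. -/
theorem contDiffAt_lagrangeMap {k : WithTop ℕ∞} {f : (κ → ℝ) → (κ → ℝ)} (C : Matrix μ κ ℝ) {z : (κ → ℝ) × (μ → ℝ)}
    (hf : ContDiffAt ℝ k f z.1) : ContDiffAt ℝ k (lagrangeMap f C) z := by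
  have h1 : ContDiffAt ℝ k (fun z : (κ → ℝ) × (μ → ℝ) => f z.1) z := hf.comp z contDiffAt_fst
  have h2 : ContDiffAt ℝ k (fun z : (κ → ℝ) × (μ → ℝ) => mulVecCLM Cᵀ z.2) z :=
    (mulVecCLM Cᵀ).contDiff.contDiffAt.comp z contDiffAt_snd
  have h3 : ContDiffAt ℝ k (fun z : (κ → ℝ) × (μ → ℝ) => mulVecCLM C z.1) z :=
    (mulVecCLM C).contDiff.contDiffAt.comp z contDiffAt_fst
  exact (h1.add h2).prodMk h3

/-- [folklore] DERIVATIVE OF THE LAGRANGE MAP: if `f` has Jacobian `H` at `z.1` then `lagrangeMap f C` has derivative `kktCLM H C` at `z`. -/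
theorem hasFDerivAt_lagrangeMap {f : (κ → ℝ) → (κ → ℝ)} (C : Matrix μ κ ℝ) {H : Matrix κ κ ℝ} {z : (κ → ℝ) × (μ → ℝ)}
    (hf : HasFDerivAt f (mulVecCLM H) z.1) : HasFDerivAt (lagrangeMap f C) (kktCLM H C) z := by
  have h1 : HasFDerivAt (fun z : (κ → ℝ) × (μ → ℝ) => f z.1) ((mulVecCLM H).comp (ContinuousLinearMap.fst ℝ _ _)) z :=
    hf.comp z hasFDerivAt_fst
  have h2 : HasFDerivAt (fun z : (κ → ℝ) × (μ → ℝ) => mulVecCLM Cᵀ z.2)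
      ((mulVecCLM Cᵀ).comp (ContinuousLinearMap.snd ℝ _ _)) z :=
    (mulVecCLM Cᵀ).hasFDerivAt.comp z hasFDerivAt_snd
  have h3 : HasFDerivAt (fun z : (κ → ℝ) × (μ → ℝ) => mulVecCLM C z.1)
      ((mulVecCLM C).comp (ContinuousLinearMap.fst ℝ _ _)) z :=
    (mulVecCLM C).hasFDerivAt.comp z hasFDerivAt_fst
  exact (h1.add h2).prodMk h3

end Lagrange

/-! ## §3 The constrained critical map (inverse function theorem for the Lagrange map) -/

section CriticalMap

variable {κ μ : Type*} [Fintype κ] [Fintype μ] [DecidableEq κ] [DecidableEq μ]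

/-- [folklore] **THE CONSTRAINED CRITICAL POINT IS A `C^k` FUNCTION OF THE CONSTRAINT VALUE.**  Let `f : (κ → ℝ) → (κ → ℝ)` (Euler–Lagrange field) be
`C^k`, `k ≠ 0`, at `V₀` with Jacobian `H` there (`HasFDerivAt f (mulVecCLM H) V₀`), let `C : Matrix μ κ ℝ` (constraints), and suppose `(V₀, ω₀)` is a
constrained critical pair, `f V₀ + Cᵀ ω₀ = 0`, with NONDEGENERATE bordered matrix `IsUnit (kkt H C).det`.  Then there are maps `U : (μ → ℝ) → (κ → ℝ)`
(critical point) and `ω : (μ → ℝ) → (μ → ℝ)` (multiplier) with: `U (C V₀) = V₀`, `ω (C V₀) = ω₀`; `U`, `ω` of class `C^k` at `C V₀`; for every `c` near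
`C V₀`, `f (U c) + Cᵀ ω c = 0` and `C (U c) = c`; every pair `(V, ω′)` near `(V₀, ω₀)` with `f V + Cᵀ ω′ = 0` IS `(U (C V), ω (C V))` (local uniqueness);
and `dU(C V₀) = minOp H C`, `dω(C V₀) = −effForm H C` (the blocks of the bordered inverse). -/
theorem exists_criticalMap {k : WithTop ℕ∞} (hk : k ≠ 0) (f : (κ → ℝ) → (κ → ℝ)) (C : Matrix μ κ ℝ) (H : Matrix κ κ ℝ)
    (V₀ : κ → ℝ) (ω₀ : μ → ℝ) (hf : ContDiffAt ℝ k f V₀) (hH : HasFDerivAt f (mulVecCLM H) V₀)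
    (hcrit : f V₀ + Cᵀ *ᵥ ω₀ = 0) (hkkt : IsUnit (kkt H C).det) :
    ∃ U : (μ → ℝ) → (κ → ℝ), ∃ ω : (μ → ℝ) → (μ → ℝ),
      U (C *ᵥ V₀) = V₀ ∧ ω (C *ᵥ V₀) = ω₀
      ∧ ContDiffAt ℝ k U (C *ᵥ V₀) ∧ ContDiffAt ℝ k ω (C *ᵥ V₀)
      ∧ (∀ᶠ c in 𝓝 (C *ᵥ V₀), f (U c) + Cᵀ *ᵥ ω c = 0 ∧ C *ᵥ U c = c)
      ∧ (∀ᶠ z in 𝓝 (V₀, ω₀), f z.1 + Cᵀ *ᵥ z.2 = 0 → z = (U (C *ᵥ z.1), ω (C *ᵥ z.1)))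
      ∧ HasFDerivAt U (mulVecCLM (minOp H C)) (C *ᵥ V₀) ∧ HasFDerivAt ω (-mulVecCLM (effForm H C)) (C *ᵥ V₀) := by
  set a : (κ → ℝ) × (μ → ℝ) := (V₀, ω₀) with ha
  have hΨk : ContDiffAt ℝ k (lagrangeMap f C) a := contDiffAt_lagrangeMap C hf
  have hΨ' : HasFDerivAt (lagrangeMap f C) (kktEquiv H C hkkt : ((κ → ℝ) × (μ → ℝ)) →L[ℝ] ((κ → ℝ) × (μ → ℝ))) a :=
    hasFDerivAt_lagrangeMap C hH
  have hΨs : HasStrictFDerivAt (lagrangeMap f C) (kktEquiv H C hkkt : ((κ → ℝ) × (μ → ℝ)) →L[ℝ] ((κ → ℝ) × (μ → ℝ))) a :=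
    hΨk.hasStrictFDerivAt' hΨ' hk
  -- the base value of the Lagrange map
  have hΨa : lagrangeMap f C a = (0, C *ᵥ V₀) := by simp [ha, hcrit]
  -- the local inverse `g`, `C^k` at `Ψ a`, with both inverse identities near the base points and derivative `kktInv`
  set g := hΨs.localInverse (lagrangeMap f C) _ a with hg
  have hgk : ContDiffAt ℝ k g (lagrangeMap f C a) := hΨk.to_localInverse hΨ' hk
  have hga : g (lagrangeMap f C a) = a := hΨs.localInverse_apply_image
  have hright : ∀ᶠ y in 𝓝 (lagrangeMap f C a), lagrangeMap f C (g y) = y := hΨs.eventually_right_inverse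
  have hleft : ∀ᶠ z in 𝓝 a, g (lagrangeMap f C z) = z := hΨs.eventually_left_inverse
  have hgd : HasFDerivAt g ((kktEquiv H C hkkt).symm : ((κ → ℝ) × (μ → ℝ)) →L[ℝ] ((κ → ℝ) × (μ → ℝ))) (lagrangeMap f C a) :=
    hΨs.to_localInverse.hasFDerivAt
  rw [hΨa] at hgk hga hright hgd
  -- the affine section `c ↦ (0, c)`
  have hsec : HasFDerivAt (fun c : μ → ℝ => ((0 : κ → ℝ), c)) (ContinuousLinearMap.inr ℝ (κ → ℝ) (μ → ℝ)) (C *ᵥ V₀) :=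
    (hasFDerivAt_const (0 : κ → ℝ) _).prodMk (hasFDerivAt_id _)
  have hseck : ContDiffAt ℝ k (fun c : μ → ℝ => ((0 : κ → ℝ), c)) (C *ᵥ V₀) := contDiffAt_const.prodMk contDiffAt_id
  have hsec_tendsto : Tendsto (fun c : μ → ℝ => ((0 : κ → ℝ), c)) (𝓝 (C *ᵥ V₀)) (𝓝 ((0 : κ → ℝ), C *ᵥ V₀)) :=
    hseck.continuousAt
  -- the composite `c ↦ g (0, c)` and its derivative
  have hcomp : HasFDerivAt (fun c : μ → ℝ => g ((0 : κ → ℝ), c))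
      (((kktEquiv H C hkkt).symm : ((κ → ℝ) × (μ → ℝ)) →L[ℝ] ((κ → ℝ) × (μ → ℝ))).comp
        (ContinuousLinearMap.inr ℝ (κ → ℝ) (μ → ℝ))) (C *ᵥ V₀) := hgd.comp _ hsec
  refine ⟨fun c => (g ((0 : κ → ℝ), c)).1, fun c => (g ((0 : κ → ℝ), c)).2, ?_, ?_, ?_, ?_, ?_, ?_, ?_, ?_⟩
  · simp only [hga, ha]
  · simp only [hga, ha]
  · exact contDiffAt_fst.comp _ (hgk.comp _ hseck)
  · exact contDiffAt_snd.comp _ (hgk.comp _ hseck)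
  · have h := hsec_tendsto.eventually hright
    filter_upwards [h] with c hc
    have hc' := hc
    simp only [lagrangeMap_apply, Prod.mk.injEq] at hc'
    exact ⟨hc'.1, hc'.2⟩
  · filter_upwards [hleft] with z hz hzcrit
    have hΨz : lagrangeMap f C z = (0, C *ᵥ z.1) := by simp [hzcrit]
    rw [hΨz] at hz
    rw [hz]
  · have h := hasFDerivAt_fst.comp _ hcomp
    refine h.congr_fderiv ?_
    ext c : 1
    simp
  · have h := hasFDerivAt_snd.comp _ hcomp
    refine h.congr_fderiv ?_
    ext c : 1
    simp

/-- [folklore] **THE TRIVIAL-BACKGROUND CASE (the (h-U) shape of K-U2e).**  `f` `C^k` at `0` with Jacobian `H`, `f 0 = 0` (the trivial configuration is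
critical) and `IsUnit (kkt H C).det` ⟹ a `C^k` constrained critical map `U` with `U 0 = 0`, multiplier `ω` with `ω 0 = 0`, the two identities near `0`, local
uniqueness, `dU(0) = minOp H C`, `dω(0) = −effForm H C`. -/
theorem exists_criticalMap_zero {k : WithTop ℕ∞} (hk : k ≠ 0) (f : (κ → ℝ) → (κ → ℝ)) (C : Matrix μ κ ℝ) (H : Matrix κ κ ℝ)
    (hf : ContDiffAt ℝ k f 0) (hH : HasFDerivAt f (mulVecCLM H) 0) (hf0 : f 0 = 0) (hkkt : IsUnit (kkt H C).det) :
    ∃ U : (μ → ℝ) → (κ → ℝ), ∃ ω : (μ → ℝ) → (μ → ℝ),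
      U 0 = 0 ∧ ω 0 = 0 ∧ ContDiffAt ℝ k U 0 ∧ ContDiffAt ℝ k ω 0
      ∧ (∀ᶠ c in 𝓝 (0 : μ → ℝ), f (U c) + Cᵀ *ᵥ ω c = 0 ∧ C *ᵥ U c = c)
      ∧ (∀ᶠ z in 𝓝 ((0 : κ → ℝ), (0 : μ → ℝ)), f z.1 + Cᵀ *ᵥ z.2 = 0 → z = (U (C *ᵥ z.1), ω (C *ᵥ z.1)))
      ∧ HasFDerivAt U (mulVecCLM (minOp H C)) 0 ∧ HasFDerivAt ω (-mulVecCLM (effForm H C)) 0 := by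
  have hcrit : f 0 + Cᵀ *ᵥ (0 : μ → ℝ) = 0 := by rw [hf0, Matrix.mulVec_zero, add_zero]
  obtain ⟨U, ω, h⟩ := exists_criticalMap hk f C H 0 0 hf hH hcrit hkkt
  rw [Matrix.mulVec_zero] at h
  exact ⟨U, ω, h⟩

end CriticalMap

/-! ## §4 The derivative formulas along the branch (differentiating the two identities) -/

section Derivatives

variable {κ μ : Type*} [Fintype κ] [Fintype μ] [DecidableEq κ] [DecidableEq μ]

/-- [folklore] **`dU = minOp`, `dω = −effForm` WHEREVER THE IDENTITIES HOLD.**  If `U`, `ω` are differentiable at `c`, satisfy `f (U c′) + Cᵀ ω c′ = 0` and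
`C (U c′) = c′` for `c′` near `c`, `f` has Jacobian `H_c` at `U c` and `kkt H_c C` is nonsingular, then `fderiv U c = mulVecCLM (minOp H_c C)` and
`fderiv ω c = −mulVecCLM (effForm H_c C)`. -/
theorem fderiv_eq_of_identities {f : (κ → ℝ) → (κ → ℝ)} {C : Matrix μ κ ℝ} {U : (μ → ℝ) → (κ → ℝ)} {ω : (μ → ℝ) → (μ → ℝ)}
    {c : μ → ℝ} {Hc : Matrix κ κ ℝ} (hU : DifferentiableAt ℝ U c) (hω : DifferentiableAt ℝ ω c)
    (hf : HasFDerivAt f (mulVecCLM Hc) (U c))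
    (hid : ∀ᶠ c' in 𝓝 c, f (U c') + Cᵀ *ᵥ ω c' = 0 ∧ C *ᵥ U c' = c') (hkkt : IsUnit (kkt Hc C).det) :
    fderiv ℝ U c = mulVecCLM (minOp Hc C) ∧ fderiv ℝ ω c = -mulVecCLM (effForm Hc C) := by
  obtain ⟨h11, h12, h21, h22⟩ := blocks_mul_kkt Hc C hkkt
  -- differentiate the first identity: `Hc ∘ dU + Cᵀ ∘ dω = 0`
  have hd1 : HasFDerivAt (fun c' => f (U c') + Cᵀ *ᵥ ω c')
      ((mulVecCLM Hc).comp (fderiv ℝ U c) + (mulVecCLM Cᵀ).comp (fderiv ℝ ω c)) c :=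
    (hf.comp c hU.hasFDerivAt).add ((mulVecCLM Cᵀ).hasFDerivAt.comp c hω.hasFDerivAt)
  have hz1 : HasFDerivAt (fun c' => f (U c') + Cᵀ *ᵥ ω c') (0 : (μ → ℝ) →L[ℝ] (κ → ℝ)) c :=
    (hasFDerivAt_const (0 : κ → ℝ) c).congr_of_eventuallyEq (hid.mono fun c' h => h.1)
  have e1 : (mulVecCLM Hc).comp (fderiv ℝ U c) + (mulVecCLM Cᵀ).comp (fderiv ℝ ω c) = 0 := hd1.unique hz1
  -- differentiate the second identity: `C ∘ dU = id`
  have hd2 : HasFDerivAt (fun c' => C *ᵥ U c') ((mulVecCLM C).comp (fderiv ℝ U c)) c :=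
    (mulVecCLM C).hasFDerivAt.comp c hU.hasFDerivAt
  have hz2 : HasFDerivAt (fun c' => C *ᵥ U c') (ContinuousLinearMap.id ℝ (μ → ℝ)) c :=
    (hasFDerivAt_id c).congr_of_eventuallyEq (hid.mono fun c' h => h.2)
  have e2 : (mulVecCLM C).comp (fderiv ℝ U c) = ContinuousLinearMap.id ℝ (μ → ℝ) := hd2.unique hz2
  -- pointwise consequences
  have p1 : ∀ d, Hc *ᵥ fderiv ℝ U c d + Cᵀ *ᵥ fderiv ℝ ω c d = 0 := fun d => by
    have := congrArg (fun L : (μ → ℝ) →L[ℝ] (κ → ℝ) => L d) e1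
    simpa using this
  have p2 : ∀ d, C *ᵥ fderiv ℝ U c d = d := fun d => by
    have := congrArg (fun L : (μ → ℝ) →L[ℝ] (μ → ℝ) => L d) e2
    simpa using this
  have hUd : ∀ d, fderiv ℝ U c d = minOp Hc C *ᵥ d := fun d => by
    have hneg : Hc *ᵥ fderiv ℝ U c d = -(Cᵀ *ᵥ fderiv ℝ ω c d) := eq_neg_of_add_eq_zero_left (p1 d)
    calc fderiv ℝ U c d = (flucCov Hc C * Hc + minOp Hc C * C) *ᵥ fderiv ℝ U c d := by rw [h11, Matrix.one_mulVec]
      _ = flucCov Hc C *ᵥ (Hc *ᵥ fderiv ℝ U c d) + minOp Hc C *ᵥ (C *ᵥ fderiv ℝ U c d) := by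
          rw [Matrix.add_mulVec, ← Matrix.mulVec_mulVec, ← Matrix.mulVec_mulVec]
      _ = minOp Hc C *ᵥ d := by
          rw [hneg, p2, Matrix.mulVec_neg, Matrix.mulVec_mulVec, h12, Matrix.zero_mulVec, neg_zero, zero_add]
  have hωd : ∀ d, fderiv ℝ ω c d = -(effForm Hc C *ᵥ d) := fun d => by
    have hneg : Cᵀ *ᵥ fderiv ℝ ω c d = -(Hc *ᵥ fderiv ℝ U c d) := eq_neg_of_add_eq_zero_right (p1 d)
    calc fderiv ℝ ω c d = (minOpL Hc C * Cᵀ) *ᵥ fderiv ℝ ω c d := by rw [h22, Matrix.one_mulVec]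
      _ = minOpL Hc C *ᵥ (Cᵀ *ᵥ fderiv ℝ ω c d) := by rw [← Matrix.mulVec_mulVec]
      _ = -(effForm Hc C *ᵥ d) := by
          rw [hneg, Matrix.mulVec_neg, Matrix.mulVec_mulVec, h21, ← Matrix.mulVec_mulVec, p2]
  constructor
  · ext d : 1
    rw [hUd, mulVecCLM_apply]
  · ext d : 1
    rw [hωd, FunLike.coe_neg, Pi.neg_apply, mulVecCLM_apply]

end Derivatives

end Summit.QuantumFields.BalabanUV.Beta.ConstrainedCriticalMap

end
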